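import Summits.ValiantsHypothesis.ValiantsHypothesis.Theorems.LacunarySymmetroidMatrixDescartesCensusDoorA34NullEndLift
import Summits.ValiantsHypothesis.ValiantsHypothesis.Theorems.LacunarySymmetroidMatrixDescartesCensusDoorA34PlaneCompression

/-!
# `MatrixDescartes` census — DOOR A at `(3,4)`: a rank-two top letter is TWO RANK-ONE GRAFTS — `det(M + a·vvᵀ + b·wwᵀ) = det M + a·vᵀadj(M)v +
# b·wᵀadj(M)w + ab·(v×w)ᵀM(v×w)`: the middle window of the null-top sheet is a signed SUM of two plane-compression determinants and the top window is the
# line compression at `v × w`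

HONEST FRAMING.  Object-search cell `pub-symmetroid`, engine seat `val-sym-eng-2` (g6); helper row beside the registered strata line
`Cruxes/DoorA34/Lines/strata.lean` on stmt-ValiantsHypothesis-19980 (`DoorA34 = PosRootLawAt 3 4 18`: OPEN, typed, never asserted here), stub `stub_nullTopCeiling`.
A singular symmetric top letter of rank two is `S₃ = a·vvᵀ + b·wwᵀ` (`ab > 0`: semidefinite cell; `ab < 0`: INDEFINITE cell — the cell of every null-top object of
record; kernel vector `k ∥ v × w`).  Applying the tree's rank-one determinant lemma (`Census.det_add_smul_vecMulVec_fin_three`) twice and the Lagrange–adjugate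
identity gives, for ANY `3 × 3` matrix over a commutative ring:

* **`det_add_two_smul_vecMulVec_fin_three`** — `det(M + a·vvᵀ + b·wwᵀ) = det M + a·vᵀ adj(M) v + b·wᵀ adj(M) w + ab·(v ×₃ w)ᵀ M (v ×₃ w)`;
* `adjugate_quadForm_add_smul_vecMulVec` — the step `wᵀ adj(M + a·vvᵀ) w = wᵀ adj(M) w + a·(v ×₃ w)ᵀ M (v ×₃ w)`.

READING for the null-top sheet (…NullTopBlocks: `det F = det G + x^{d₃}·tr(adj G·S₃) + x^{2d₃}·tr(adj S₃·G)`): with `M = G(x)` the MIDDLE WINDOW is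
`a·q_v + b·q_w`, `q_u = uᵀ adj G u = det(G|_{u^⊥})` (…PlaneCompression), a signed SUM of two plane-compression determinants, and the TOP WINDOW is `ab·kᵀGk`
at `k = v × w`.  Consequence for the line's flag accounting (seat report HOME/DOOR-A34-ENG2G6-REPORT.md §3b): the kernel FLAG LAW (…FlagLaw, «past a
middle-type root, five roots of ONE plane compression forbid a later root of the level-2 trinomial on that plane») governs the near-rank-one regime
`|b| ≪ |a|` (all seventeens of record, where the middle window is `≈ a·q_v`), but NOT the genuinely indefinite top letter, whose middle window `a·q_v − |b|·q_w`
has no definite sign at middle-type roots; located probe (hub): on the cores of record no `(v, w, b/a)` reaches five middle-window roots beyond the core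
(max `(4,2)`, the objects' own flag).  Nothing here bounds anything; `DoorA34` and the three stubs stay OPEN; registers unchanged; nothing on `MatrixDescartes`
(stmt-ValiantsHypothesis-18050) or `VP ≠ VNP` — VP≠VNP not moved.  [folklore] rank-one updates of `3 × 3` determinants; `ring`.
-/

-- `Summit.ValiantsHypothesis.ValiantsHypothesis.…` repeats a component by the D-0017 layout
-- (single-conjunct summit), which the `dupNamespace` linter flags; the name is mandated.
set_option linter.dupNamespace false

namespace Summit.ValiantsHypothesis.ValiantsHypothesis.Theorems.LacunarySymmetroidMatrixDescartes.Census

open scoped BigOperators Matrix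
open Matrix

/-- **Adjugate quadratic form after one rank-one graft**: `wᵀ adj(M + a·vvᵀ) w = wᵀ adj(M) w + a·(v × w)ᵀ M (v × w)` (any `3 × 3` matrix over a
commutative ring). [folklore] -/
theorem adjugate_quadForm_add_smul_vecMulVec {R : Type*} [CommRing R] (M : Matrix (Fin 3) (Fin 3) R) (a : R) (v w : Fin 3 → R) :
    w ⬝ᵥ ((M + a • Matrix.vecMulVec v v).adjugate *ᵥ w) = w ⬝ᵥ (M.adjugate *ᵥ w) + a * ((v ⨯₃ w) ⬝ᵥ (M *ᵥ (v ⨯₃ w))) := by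
  simp only [Matrix.adjugate_fin_three, Matrix.add_apply, Matrix.vecMulVec_apply, Matrix.smul_apply, smul_eq_mul, Matrix.mulVec,
    dotProduct, Fin.sum_univ_three, Matrix.of_apply, Matrix.cons_val', Matrix.cons_val_zero, Matrix.cons_val_one, Matrix.head_cons,
    Matrix.cons_val_two, Matrix.tail_cons, Matrix.empty_val', Matrix.cons_val_fin_one, Matrix.head_fin_const, cross_apply]
  ring

/-- **A RANK-TWO LETTER IS TWO RANK-ONE GRAFTS**: `det(M + a·vvᵀ + b·wwᵀ) = det M + a·vᵀadj(M)v + b·wᵀadj(M)w + ab·(v × w)ᵀ M (v × w)` (any `3 × 3`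
matrix over a commutative ring; for the null-top sheet with `S₃ = a·vvᵀ + b·wwᵀ`: middle window `a·q_v + b·q_w`, top window `ab·kᵀGk`, `k = v × w`). [folklore] -/
theorem det_add_two_smul_vecMulVec_fin_three {R : Type*} [CommRing R] (M : Matrix (Fin 3) (Fin 3) R) (a b : R) (v w : Fin 3 → R) :
    (M + a • Matrix.vecMulVec v v + b • Matrix.vecMulVec w w).det
      = M.det + a * (v ⬝ᵥ (M.adjugate *ᵥ v)) + b * (w ⬝ᵥ (M.adjugate *ᵥ w)) + a * b * ((v ⨯₃ w) ⬝ᵥ (M *ᵥ (v ⨯₃ w))) := by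
  rw [det_add_smul_vecMulVec_fin_three, det_add_smul_vecMulVec_fin_three, adjugate_quadForm_add_smul_vecMulVec]
  ring

end Summit.ValiantsHypothesis.ValiantsHypothesis.Theorems.LacunarySymmetroidMatrixDescartes.Census
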